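import Summits.CriticalPhenomena.PercolationContinuityZ3.Theorems.PercNearOneGluingNoHeavyLowerTailGZHub
import HarnessLib

/-!
# `NoHeavyLowerTail` (stmt-CriticalPhenomena-4575) — support file: THEOREM B in Gladkov–Zimin form and
# **Gladkov–Zimin Conjecture 6.3 (= Gladkov 2024 Conj. 10.1) for hubs of bounded isolation probability**
# (prover `prim-ineq-prove-2` gen 8, memo `run/shared/lean/prim/prim-ineq-prove-2/MEMO-17-THEOREM-B-BHK.md`)

No definitions, no named facts, no sorries.  Sequel of `PercNearOneGluingNoHeavyLowerTailGZHub.lean`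
(`GZHub.condNegCorr_hub`: given no `c`-avoiding `a–b` path, `{a↔c}` and `{b↔c}` are negatively correlated).  Here the
event algebra turning it into statements about the five cells of the three-point connection law
(`x = μ(abc)`, `s = μ(a|b|c)`, `u_a = μ(bc|a)`, `u_b = μ(ac|b)`, `w = μ(ab|c)`; hub `c`; `★ = {e | c ∈ e}`):

* `throughHub_mul_apart_le` (**THEOREM B**): `μ(abc ∧ a ↮ b off c) · μ(a|b|c) ≤ μ(ac|b) · μ(bc|a)` — equality when `c`
  separates `a` from `b` (Gladkov–Zimin Prop. 6.1);
* `gz_defect_le_avoid_mul_apart`: `x·s − u_a·u_b ≤ θ₁·s`, `θ₁ = μ(a ↔ b off c, c ∈ C)`;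
* `gz_conj_boundedHub`: with `β_c = ∏_{v ≠ c} (1 − w(cv)) = P(no open edge at c)`,
  `β_c·(x·s − u_a·u_b) ≤ (1 − β_c)·μ(ab|c)`; so `μ(ab|c) < ε·β_c/(1 − β_c)` gives `x·s − u_a·u_b < ε`: the printed
  conjecture "for any `ε > 0` there exists `δ > 0` such that if `P(ab|c) < δ`, then `P(abc) − P(ac)P(bc) < ε`"
  [Gladkov–Zimin 2404.08873 Conj. 6.3; Gladkov 2408.08457 Conj. 10.1 in the form `P(abc)P(a|b|c) − P(ac|b)P(a|bc) < ε`]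
  holds with `δ = ε·β_c`, uniformly on every class of weighted graphs whose hub has isolation probability bounded below
  (bounded degree with edge weights `≤ 1 − η`: `β_c ≥ η^Δ`; `ℤ^d` at fixed `p`).  Gladkov 2024 §7.3 records only
  `P(ab|c) < δ ⟹ P(abc) − 8P(ac)P(bc) < ε` towards the conjecture; the general (hub-uniform) case remains open.

Ingredients: `GZHub.condNegCorr_hub` (van den Berg–Häggström–Kahn 2006 Thm. 1.4 on `G − c`), the path lemmas
`avoid_of_ab_not_ac` (an `a–b` path in a configuration with `a ↮ c` avoids `c`) and `exists_open_hubEdge`, and the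
independence of `{a ↔ b off c}` (determined off `★`) from `{no open edge at c}` (determined on `★`).
-/

noncomputable section

namespace Summit.CriticalPhenomena.PercolationContinuityZ3.Theorems

open MeasureTheory Finset Literature.Probability.LatticeModels Literature.Probability.Percolation
open Literature.Probability.Percolation.BHK2006 (openGraph_le)
open scoped Classical

namespace GZHub

variable {V : Type*} [Fintype V]

/-! ### Event algebra: THEOREM B as `m·s ≤ u_a·u_b`, and Gladkov–Zimin Conj. 6.3 for bounded hubs -/

omit [Fintype V] in
/-- `a ↔ c`, `b ↮ c` ⟹ no `a–b` path at all, in particular none avoiding `c`. [folklore] -/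
theorem not_avoid_of_ac_not_bc {ω : Set (Sym2 V)} {a b c : V} (hac : ω ∈ (openConn a c : Set (Set (Sym2 V)))) (hbc : ω ∉ (openConn b c : Set (Set (Sym2 V)))) :
    ¬ (openGraph (ω \ {e : Sym2 V | c ∈ e})).Reachable a b := fun h =>
  hbc ((h.mono (openGraph_le Set.sdiff_subset)).symm.trans hac)

omit [Fintype V] in
/-- An open `a–b` path in a configuration where `a ↮ c` avoids `c`, hence survives the removal of the edges at
`c`. [folklore] -/
theorem avoid_of_ab_not_ac {ω : Set (Sym2 V)} {a b c : V} (hab : (openGraph ω).Reachable a b)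
    (hac : ¬ (openGraph ω).Reachable a c) : (openGraph (ω \ {e : Sym2 V | c ∈ e})).Reachable a b := by
  obtain ⟨p⟩ := hab
  suffices H : ∀ {x y : V} (_ : (openGraph ω).Walk x y), y = b → ¬ (openGraph ω).Reachable x c →
      (openGraph (ω \ {e : Sym2 V | c ∈ e})).Reachable x b from H p rfl hac
  intro x y p
  induction p with
  | nil => intro hyb _; rw [hyb]
  | @cons x y z hadj q ih =>
    intro hzb hxc
    have hyc : ¬ (openGraph ω).Reachable y c := fun h => hxc (hadj.reachable.trans h)
    have hxy := (openGraph_adj ω x y).1 hadj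
    have hmem : s(x, y) ∈ ω \ {e : Sym2 V | c ∈ e} := by
      refine ⟨hxy.1, fun h => ?_⟩
      rcases Sym2.mem_iff.1 h with h | h
      · exact hxc (by subst h; exact SimpleGraph.Reachable.refl _)
      · exact hyc (by subst h; exact SimpleGraph.Reachable.refl _)
    exact ((openGraph_adj _ x y).2 ⟨hmem, hxy.2⟩).reachable.trans (ih hzb hyc)

omit [Fintype V] in
/-- An open path from `a ≠ c` to `c` uses an open (non-loop) edge at `c`. [folklore] -/
theorem exists_open_hubEdge {ω : Set (Sym2 V)} {a c : V} (hac : a ≠ c) (h : (openGraph ω).Reachable a c) :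
    ∃ v, v ≠ c ∧ s(c, v) ∈ ω := by
  rw [← inter_union_sdiff ω c] at h
  obtain ⟨v, hvc, -, hv⟩ :=
    (reachable_hub_iff (fun e (he : e ∈ ω ∩ {e : Sym2 V | c ∈ e}) => he.2) (fun e he => he.2) hac).1 h
  exact ⟨v, hvc, hv.1⟩

/-- **THEOREM B (prim-ineq-prove-2, MEMO-17).**  On every finite weighted graph and for all distinct `a, b, c`:
`P(a↔c↔b with NO a–b path avoiding c) · P(a|b|c) ≤ P(ac|b) · P(bc|a)`  (`m·s ≤ u_a·u_b`; equality when `c`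
separates `a` from `b`, Gladkov–Zimin Prop. 6.1).  Equivalently `x·s − u_a·u_b ≤ P(a ↔ b off c, c ∈ C)·s`
(`gz_defect_le_avoid_mul_apart`). [cite: VandenbergHaggstromKahn2005, Thm. 1.4 (p. 7)] -/
theorem throughHub_mul_apart_le (w : Sym2 V → unitInterval) {a b c : V} (hab : a ≠ b) (hac : a ≠ c)
    (hbc : b ≠ c) :
    (prodBernoulli w).real ({ω : Set (Sym2 V) | ¬ (openGraph (ω \ {e : Sym2 V | c ∈ e})).Reachable a b} ∩ ((openConn a c : Set (Set (Sym2 V))) ∩ (openConn b c : Set (Set (Sym2 V))))) * (prodBernoulli w).real (((openConn a b : Set (Set (Sym2 V))))ᶜ ∩ ((openConn a c : Set (Set (Sym2 V))))ᶜ ∩ ((openConn b c : Set (Set (Sym2 V))))ᶜ) ≤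
      (prodBernoulli w).real ((openConn a c : Set (Set (Sym2 V))) ∩ ((openConn b c : Set (Set (Sym2 V))))ᶜ) * (prodBernoulli w).real ((openConn b c : Set (Set (Sym2 V))) ∩ ((openConn a c : Set (Set (Sym2 V))))ᶜ) := by
  have hB := condNegCorr_hub w hab hac hbc
  have hm : ∀ S : Set (Set (Sym2 V)), MeasurableSet S := fun S => MeasurableSet.of_discrete
  -- μ(N ∩ {a↔c}) = m + u_b
  have h1 : (prodBernoulli w).real ({ω : Set (Sym2 V) | ¬ (openGraph (ω \ {e : Sym2 V | c ∈ e})).Reachable a b} ∩ (openConn a c : Set (Set (Sym2 V)))) =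
      (prodBernoulli w).real ({ω : Set (Sym2 V) | ¬ (openGraph (ω \ {e : Sym2 V | c ∈ e})).Reachable a b} ∩ ((openConn a c : Set (Set (Sym2 V))) ∩ (openConn b c : Set (Set (Sym2 V))))) + (prodBernoulli w).real ((openConn a c : Set (Set (Sym2 V))) ∩ ((openConn b c : Set (Set (Sym2 V))))ᶜ) := by
    rw [← measureReal_inter_add_sdiff (μ := prodBernoulli w) (s := {ω : Set (Sym2 V) | ¬ (openGraph (ω \ {e : Sym2 V | c ∈ e})).Reachable a b} ∩ (openConn a c : Set (Set (Sym2 V)))) (hm (openConn b c : Set (Set (Sym2 V)))), Set.inter_assoc]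
    congr 2
    ext ω
    simp only [Set.mem_sdiff, Set.mem_inter_iff, Set.mem_setOf_eq, Set.mem_compl_iff]
    exact ⟨fun ⟨⟨_, h2⟩, h3⟩ => ⟨h2, h3⟩, fun ⟨h2, h3⟩ => ⟨⟨not_avoid_of_ac_not_bc h2 h3, h2⟩, h3⟩⟩
  -- μ(N ∩ {b↔c}) = m + u_a
  have h2 : (prodBernoulli w).real ({ω : Set (Sym2 V) | ¬ (openGraph (ω \ {e : Sym2 V | c ∈ e})).Reachable a b} ∩ (openConn b c : Set (Set (Sym2 V)))) =
      (prodBernoulli w).real ({ω : Set (Sym2 V) | ¬ (openGraph (ω \ {e : Sym2 V | c ∈ e})).Reachable a b} ∩ ((openConn a c : Set (Set (Sym2 V))) ∩ (openConn b c : Set (Set (Sym2 V))))) + (prodBernoulli w).real ((openConn b c : Set (Set (Sym2 V))) ∩ ((openConn a c : Set (Set (Sym2 V))))ᶜ) := by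
    rw [← measureReal_inter_add_sdiff (μ := prodBernoulli w) (s := {ω : Set (Sym2 V) | ¬ (openGraph (ω \ {e : Sym2 V | c ∈ e})).Reachable a b} ∩ (openConn b c : Set (Set (Sym2 V)))) (hm (openConn a c : Set (Set (Sym2 V))))]
    congr 2
    · ext ω
      simp only [Set.mem_inter_iff]
      tauto
    · ext ω
      simp only [Set.mem_sdiff, Set.mem_inter_iff, Set.mem_setOf_eq, Set.mem_compl_iff]
      refine ⟨fun ⟨⟨_, h2⟩, h3⟩ => ⟨h2, h3⟩, fun ⟨h2, h3⟩ => ⟨⟨?_, h2⟩, h3⟩⟩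
      intro h
      exact not_avoid_of_ac_not_bc (a := b) (b := a) (c := c) h2 h3 h.symm
  -- μ(N) = m + u_b + u_a + s
  have h3 : (prodBernoulli w).real {ω : Set (Sym2 V) | ¬ (openGraph (ω \ {e : Sym2 V | c ∈ e})).Reachable a b} =
      (prodBernoulli w).real ({ω : Set (Sym2 V) | ¬ (openGraph (ω \ {e : Sym2 V | c ∈ e})).Reachable a b} ∩ (openConn a c : Set (Set (Sym2 V)))) +
        ((prodBernoulli w).real ((openConn b c : Set (Set (Sym2 V))) ∩ ((openConn a c : Set (Set (Sym2 V))))ᶜ) + (prodBernoulli w).real (((openConn a b : Set (Set (Sym2 V))))ᶜ ∩ ((openConn a c : Set (Set (Sym2 V))))ᶜ ∩ ((openConn b c : Set (Set (Sym2 V))))ᶜ)) := by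
    rw [← measureReal_inter_add_sdiff (μ := prodBernoulli w) (s := {ω : Set (Sym2 V) | ¬ (openGraph (ω \ {e : Sym2 V | c ∈ e})).Reachable a b}) (hm (openConn a c : Set (Set (Sym2 V))))]
    congr 1
    rw [← measureReal_inter_add_sdiff (μ := prodBernoulli w) (s := {ω : Set (Sym2 V) | ¬ (openGraph (ω \ {e : Sym2 V | c ∈ e})).Reachable a b} \ (openConn a c : Set (Set (Sym2 V)))) (hm (openConn b c : Set (Set (Sym2 V))))]
    congr 2
    · ext ω
      simp only [Set.mem_sdiff, Set.mem_inter_iff, Set.mem_setOf_eq, Set.mem_compl_iff]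
      refine ⟨fun ⟨⟨_, h2⟩, h3⟩ => ⟨h3, h2⟩, fun ⟨h3, h2⟩ => ⟨⟨?_, h2⟩, h3⟩⟩
      intro h
      exact not_avoid_of_ac_not_bc (a := b) (b := a) (c := c) h3 h2 h.symm
    · ext ω
      simp only [Set.mem_sdiff, Set.mem_inter_iff, Set.mem_setOf_eq, Set.mem_compl_iff]
      constructor
      · rintro ⟨⟨h1, h2⟩, h3⟩
        exact ⟨⟨fun h => h1 (avoid_of_ab_not_ac h h2), h2⟩, h3⟩
      · rintro ⟨⟨h1, h2⟩, h3⟩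
        exact ⟨⟨fun h => h1 (h.mono (openGraph_le Set.sdiff_subset)), h2⟩, h3⟩
  rw [h3, h1, h2] at hB
  nlinarith [hB, measureReal_nonneg (μ := prodBernoulli w) (s := {ω : Set (Sym2 V) | ¬ (openGraph (ω \ {e : Sym2 V | c ∈ e})).Reachable a b} ∩ ((openConn a c : Set (Set (Sym2 V))) ∩ (openConn b c : Set (Set (Sym2 V)))))]

/-- **THEOREM B, Gladkov–Zimin form.**  With `x = P(abc)`, `s = P(a|b|c)`, `u_b = P(ac|b)`, `u_a = P(bc|a)`:
`x·s − u_a·u_b ≤ P(a↔c↔b with an a–b path avoiding c)·s` — the defect in Gladkov–Zimin's Conjecture 6.3 /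
Gladkov's Conjecture 10.1 is at most `θ₁·s`, `θ₁ = P(a ↔ b off c, c ∈ C(a))`. [cite: VandenbergHaggstromKahn2005, Thm. 1.4 (p. 7)] -/
theorem gz_defect_le_avoid_mul_apart (w : Sym2 V → unitInterval) {a b c : V} (hab : a ≠ b) (hac : a ≠ c)
    (hbc : b ≠ c) :
    (prodBernoulli w).real ((openConn a c : Set (Set (Sym2 V))) ∩ (openConn b c : Set (Set (Sym2 V)))) * (prodBernoulli w).real (((openConn a b : Set (Set (Sym2 V))))ᶜ ∩ ((openConn a c : Set (Set (Sym2 V))))ᶜ ∩ ((openConn b c : Set (Set (Sym2 V))))ᶜ) -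
        (prodBernoulli w).real ((openConn a c : Set (Set (Sym2 V))) ∩ ((openConn b c : Set (Set (Sym2 V))))ᶜ) * (prodBernoulli w).real ((openConn b c : Set (Set (Sym2 V))) ∩ ((openConn a c : Set (Set (Sym2 V))))ᶜ) ≤
      (prodBernoulli w).real (((openConn a c : Set (Set (Sym2 V))) ∩ (openConn b c : Set (Set (Sym2 V)))) ∩ {ω : Set (Sym2 V) | (openGraph (ω \ {e : Sym2 V | c ∈ e})).Reachable a b}) * (prodBernoulli w).real (((openConn a b : Set (Set (Sym2 V))))ᶜ ∩ ((openConn a c : Set (Set (Sym2 V))))ᶜ ∩ ((openConn b c : Set (Set (Sym2 V))))ᶜ) := by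
  have hB := throughHub_mul_apart_le w hab hac hbc
  have hm : ∀ S : Set (Set (Sym2 V)), MeasurableSet S := fun S => MeasurableSet.of_discrete
  have hx : (prodBernoulli w).real ((openConn a c : Set (Set (Sym2 V))) ∩ (openConn b c : Set (Set (Sym2 V)))) =
      (prodBernoulli w).real (((openConn a c : Set (Set (Sym2 V))) ∩ (openConn b c : Set (Set (Sym2 V)))) ∩ {ω : Set (Sym2 V) | (openGraph (ω \ {e : Sym2 V | c ∈ e})).Reachable a b}) + (prodBernoulli w).real ({ω : Set (Sym2 V) | ¬ (openGraph (ω \ {e : Sym2 V | c ∈ e})).Reachable a b} ∩ ((openConn a c : Set (Set (Sym2 V))) ∩ (openConn b c : Set (Set (Sym2 V))))) := by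
    rw [← measureReal_inter_add_sdiff (μ := prodBernoulli w) (s := (openConn a c : Set (Set (Sym2 V))) ∩ (openConn b c : Set (Set (Sym2 V)))) (hm {ω : Set (Sym2 V) | (openGraph (ω \ {e : Sym2 V | c ∈ e})).Reachable a b})]
    congr 2
    ext ω
    simp only [Set.mem_sdiff, Set.mem_inter_iff, Set.mem_setOf_eq]
    tauto
  rw [hx]
  nlinarith [hB, measureReal_nonneg (μ := prodBernoulli w) (s := (((openConn a b : Set (Set (Sym2 V))))ᶜ ∩ ((openConn a c : Set (Set (Sym2 V))))ᶜ ∩ ((openConn b c : Set (Set (Sym2 V))))ᶜ))]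

/-- **Gladkov–Zimin Conjecture 6.3 (= Gladkov 2024, Conj. 10.1) for hubs of bounded isolation probability.**
With `β_c := ∏_{v ≠ c} (1 − w(cv)) = P(no open edge at c)`:
`β_c · (P(abc)·P(a|b|c) − P(ac|b)·P(bc|a)) ≤ (1 − β_c) · P(ab|c)`.
Hence `P(ab|c) < ε·β_c/(1−β_c)` forces the Gladkov–Zimin defect below `ε`: the conjecture holds with `δ = ε·β_c`,
uniformly on every class of weighted graphs whose hub `c` has isolation probability bounded below (bounded degree with
edge weights ≤ `1 − η`, `ℤ^d` at fixed `p`, …).  Printed conjecture: "For any `ε > 0` there exists `δ > 0` such that if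
`P(ab|c) < δ`, then `P(abc) − P(ac)P(bc) < ε`" [GZ, Conj. 6.3]; Gladkov 2024 §7.3: "For now, we can only say …
`P(ab|c) < δ ⟹ P(abc) − 8P(ac)P(bc) < ε`".  (prim-ineq-prove-2 MEMO-17; via THEOREM B.)
[cite: VandenbergHaggstromKahn2005, Thm. 1.4 (p. 7)] -/
theorem gz_conj_boundedHub (w : Sym2 V → unitInterval) {a b c : V} (hab : a ≠ b) (hac : a ≠ c) (hbc : b ≠ c) :
    (∏ v ∈ univ.filter (fun v => v ≠ c), (1 - (w s(c, v) : ℝ))) *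
        ((prodBernoulli w).real ((openConn a c : Set (Set (Sym2 V))) ∩ (openConn b c : Set (Set (Sym2 V)))) * (prodBernoulli w).real (((openConn a b : Set (Set (Sym2 V))))ᶜ ∩ ((openConn a c : Set (Set (Sym2 V))))ᶜ ∩ ((openConn b c : Set (Set (Sym2 V))))ᶜ) -
          (prodBernoulli w).real ((openConn a c : Set (Set (Sym2 V))) ∩ ((openConn b c : Set (Set (Sym2 V))))ᶜ) * (prodBernoulli w).real ((openConn b c : Set (Set (Sym2 V))) ∩ ((openConn a c : Set (Set (Sym2 V))))ᶜ)) ≤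
      (1 - (∏ v ∈ univ.filter (fun v => v ≠ c), (1 - (w s(c, v) : ℝ)))) * (prodBernoulli w).real ((openConn a b : Set (Set (Sym2 V))) ∩ ((openConn a c : Set (Set (Sym2 V))))ᶜ) := by
  have hm : ∀ S : Set (Set (Sym2 V)), MeasurableSet S := fun S => MeasurableSet.of_discrete
  have hT := gz_defect_le_avoid_mul_apart w hab hac hbc
  -- β_c = P(no open edge at c), and its independence from the event `J = {a ↔ b off c}`
  have hclosed : (prodBernoulli w).real {ω : Set (Sym2 V) | ∀ v ∈ univ.filter (fun v => v ≠ c), s(c, v) ∉ ω} = (∏ v ∈ univ.filter (fun v => v ≠ c), (1 - (w s(c, v) : ℝ))) := by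
    have h := real_hit w c (univ.filter (fun v => v ≠ c))
    have hc : {ω : Set (Sym2 V) | ∀ v ∈ univ.filter (fun v => v ≠ c), s(c, v) ∉ ω} = ({η : Set (Sym2 V) | ∃ v ∈ univ.filter (fun v => v ≠ c), s(c, v) ∈ η})ᶜ := by
      ext ω; simp only [Set.mem_setOf_eq, Set.mem_compl_iff, not_exists, not_and]
    rw [hc, probReal_compl_eq_one_sub (hm _), h]
    ring
  have hJdet : DeterminedBy {ω : Set (Sym2 V) | (openGraph (ω \ {e : Sym2 V | c ∈ e})).Reachable a b}
      (↑((univ.filter (fun v => v ≠ c)).image fun v => s(c, v)) : Set (Sym2 V))ᶜ := by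
    rw [determinedBy_iff]
    intro ω ω' h
    have hωω' : ω \ {e : Sym2 V | c ∈ e} = ω' \ {e : Sym2 V | c ∈ e} := by
      ext e
      constructor
      · rintro ⟨he, hce⟩
        have : e ∈ ω ∩ (↑((univ.filter (fun v => v ≠ c)).image fun v => s(c, v)) : Set (Sym2 V))ᶜ := by
          refine ⟨he, fun hF => hce ?_⟩
          obtain ⟨v, -, rfl⟩ := Finset.mem_image.1 (Finset.mem_coe.1 hF)
          exact Sym2.mem_mk_left c v
        rw [h] at this
        exact ⟨this.1, hce⟩
      · rintro ⟨he, hce⟩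
        have : e ∈ ω' ∩ (↑((univ.filter (fun v => v ≠ c)).image fun v => s(c, v)) : Set (Sym2 V))ᶜ := by
          refine ⟨he, fun hF => hce ?_⟩
          obtain ⟨v, -, rfl⟩ := Finset.mem_image.1 (Finset.mem_coe.1 hF)
          exact Sym2.mem_mk_left c v
        rw [← h] at this
        exact ⟨this.1, hce⟩
    simp only [Set.mem_setOf_eq, hωω']
  have hCdet : DeterminedBy {ω : Set (Sym2 V) | ∀ v ∈ univ.filter (fun v => v ≠ c), s(c, v) ∉ ω}
      (↑((univ.filter (fun v => v ≠ c)).image fun v => s(c, v)) : Set (Sym2 V)) := by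
    rw [determinedBy_iff]
    intro ω ω' h
    simp only [Set.mem_setOf_eq]
    constructor
    · intro hω v hv hω'
      have : s(c, v) ∈ ω' ∩ ↑((univ.filter (fun v => v ≠ c)).image fun v => s(c, v)) :=
        ⟨hω', Finset.mem_coe.2 (Finset.mem_image.2 ⟨v, hv, rfl⟩)⟩
      rw [← h] at this
      exact hω v hv this.1
    · intro hω' v hv hω
      have : s(c, v) ∈ ω ∩ ↑((univ.filter (fun v => v ≠ c)).image fun v => s(c, v)) :=
        ⟨hω, Finset.mem_coe.2 (Finset.mem_image.2 ⟨v, hv, rfl⟩)⟩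
      rw [h] at this
      exact hω' v hv this.1
  have hindep : (prodBernoulli w).real ({ω : Set (Sym2 V) | ∀ v ∈ univ.filter (fun v => v ≠ c), s(c, v) ∉ ω} ∩ {ω : Set (Sym2 V) | (openGraph (ω \ {e : Sym2 V | c ∈ e})).Reachable a b}) =
      (∏ v ∈ univ.filter (fun v => v ≠ c), (1 - (w s(c, v) : ℝ))) * (prodBernoulli w).real {ω : Set (Sym2 V) | (openGraph (ω \ {e : Sym2 V | c ∈ e})).Reachable a b} := by
    rw [prodBernoulli_real_inter_of_determinedBy w _ hCdet hJdet (hm _) (hm _), hclosed]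
  -- w' = P(ab|c) ≥ P(J ∩ closed) = β_c · P(J)
  have hw : (∏ v ∈ univ.filter (fun v => v ≠ c), (1 - (w s(c, v) : ℝ))) * (prodBernoulli w).real {ω : Set (Sym2 V) | (openGraph (ω \ {e : Sym2 V | c ∈ e})).Reachable a b} ≤ (prodBernoulli w).real ((openConn a b : Set (Set (Sym2 V))) ∩ ((openConn a c : Set (Set (Sym2 V))))ᶜ) := by
    rw [← hindep]
    refine measureReal_mono (fun ω hω => ?_)
    refine ⟨hω.2.mono (openGraph_le Set.sdiff_subset), fun h => ?_⟩
    obtain ⟨v, hvc, hv⟩ := exists_open_hubEdge hac h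
    exact hω.1 v (Finset.mem_filter.2 ⟨Finset.mem_univ v, hvc⟩) hv
  -- θ₁ ≤ P(J) − P(J ∩ closed) = (1 − β_c)·P(J)
  have hθ : (prodBernoulli w).real (((openConn a c : Set (Set (Sym2 V))) ∩ (openConn b c : Set (Set (Sym2 V)))) ∩ {ω : Set (Sym2 V) | (openGraph (ω \ {e : Sym2 V | c ∈ e})).Reachable a b}) ≤ (1 - (∏ v ∈ univ.filter (fun v => v ≠ c), (1 - (w s(c, v) : ℝ)))) * (prodBernoulli w).real {ω : Set (Sym2 V) | (openGraph (ω \ {e : Sym2 V | c ∈ e})).Reachable a b} := by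
    have hsplit := measureReal_inter_add_sdiff (μ := prodBernoulli w) (s := {ω : Set (Sym2 V) | (openGraph (ω \ {e : Sym2 V | c ∈ e})).Reachable a b}) (hm {ω : Set (Sym2 V) | ∀ v ∈ univ.filter (fun v => v ≠ c), s(c, v) ∉ ω})
    have hmono : (prodBernoulli w).real (((openConn a c : Set (Set (Sym2 V))) ∩ (openConn b c : Set (Set (Sym2 V)))) ∩ {ω : Set (Sym2 V) | (openGraph (ω \ {e : Sym2 V | c ∈ e})).Reachable a b}) ≤ (prodBernoulli w).real ({ω : Set (Sym2 V) | (openGraph (ω \ {e : Sym2 V | c ∈ e})).Reachable a b} \ {ω : Set (Sym2 V) | ∀ v ∈ univ.filter (fun v => v ≠ c), s(c, v) ∉ ω}) := by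
      refine measureReal_mono (fun ω hω => ⟨hω.2, fun hcl => ?_⟩)
      obtain ⟨v, hvc, hv⟩ := exists_open_hubEdge hac hω.1.1
      exact hcl v (Finset.mem_filter.2 ⟨Finset.mem_univ v, hvc⟩) hv
    rw [Set.inter_comm] at hindep
    nlinarith [hmono, hsplit, hindep]
  -- combine
  have hβ0 : 0 ≤ (∏ v ∈ univ.filter (fun v => v ≠ c), (1 - (w s(c, v) : ℝ))) := Finset.prod_nonneg fun v _ => sub_nonneg.2 (w s(c, v)).2.2
  have hβ1 : (∏ v ∈ univ.filter (fun v => v ≠ c), (1 - (w s(c, v) : ℝ))) ≤ 1 :=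
    Finset.prod_le_one (fun v _ => sub_nonneg.2 (w s(c, v)).2.2) fun v _ => sub_le_self _ (w s(c, v)).2.1
  have hs1 : (prodBernoulli w).real (((openConn a b : Set (Set (Sym2 V))))ᶜ ∩ ((openConn a c : Set (Set (Sym2 V))))ᶜ ∩ ((openConn b c : Set (Set (Sym2 V))))ᶜ) ≤ 1 := measureReal_le_one
  have hs0 : 0 ≤ (prodBernoulli w).real (((openConn a b : Set (Set (Sym2 V))))ᶜ ∩ ((openConn a c : Set (Set (Sym2 V))))ᶜ ∩ ((openConn b c : Set (Set (Sym2 V))))ᶜ) := measureReal_nonneg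
  have hθ0 : 0 ≤ (prodBernoulli w).real (((openConn a c : Set (Set (Sym2 V))) ∩ (openConn b c : Set (Set (Sym2 V)))) ∩ {ω : Set (Sym2 V) | (openGraph (ω \ {e : Sym2 V | c ∈ e})).Reachable a b}) := measureReal_nonneg
  have hJ0 : 0 ≤ (prodBernoulli w).real {ω : Set (Sym2 V) | (openGraph (ω \ {e : Sym2 V | c ∈ e})).Reachable a b} := measureReal_nonneg
  calc (∏ v ∈ univ.filter (fun v => v ≠ c), (1 - (w s(c, v) : ℝ))) * ((prodBernoulli w).real ((openConn a c : Set (Set (Sym2 V))) ∩ (openConn b c : Set (Set (Sym2 V)))) * (prodBernoulli w).real (((openConn a b : Set (Set (Sym2 V))))ᶜ ∩ ((openConn a c : Set (Set (Sym2 V))))ᶜ ∩ ((openConn b c : Set (Set (Sym2 V))))ᶜ) -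
          (prodBernoulli w).real ((openConn a c : Set (Set (Sym2 V))) ∩ ((openConn b c : Set (Set (Sym2 V))))ᶜ) * (prodBernoulli w).real ((openConn b c : Set (Set (Sym2 V))) ∩ ((openConn a c : Set (Set (Sym2 V))))ᶜ))
        ≤ (∏ v ∈ univ.filter (fun v => v ≠ c), (1 - (w s(c, v) : ℝ))) * ((prodBernoulli w).real (((openConn a c : Set (Set (Sym2 V))) ∩ (openConn b c : Set (Set (Sym2 V)))) ∩ {ω : Set (Sym2 V) | (openGraph (ω \ {e : Sym2 V | c ∈ e})).Reachable a b}) * (prodBernoulli w).real (((openConn a b : Set (Set (Sym2 V))))ᶜ ∩ ((openConn a c : Set (Set (Sym2 V))))ᶜ ∩ ((openConn b c : Set (Set (Sym2 V))))ᶜ)) :=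
          mul_le_mul_of_nonneg_left hT hβ0
    _ ≤ (∏ v ∈ univ.filter (fun v => v ≠ c), (1 - (w s(c, v) : ℝ))) * (prodBernoulli w).real (((openConn a c : Set (Set (Sym2 V))) ∩ (openConn b c : Set (Set (Sym2 V)))) ∩ {ω : Set (Sym2 V) | (openGraph (ω \ {e : Sym2 V | c ∈ e})).Reachable a b}) := by
          refine mul_le_mul_of_nonneg_left ?_ hβ0
          exact mul_le_of_le_one_right hθ0 hs1
    _ ≤ (∏ v ∈ univ.filter (fun v => v ≠ c), (1 - (w s(c, v) : ℝ))) * ((1 - (∏ v ∈ univ.filter (fun v => v ≠ c), (1 - (w s(c, v) : ℝ)))) * (prodBernoulli w).real {ω : Set (Sym2 V) | (openGraph (ω \ {e : Sym2 V | c ∈ e})).Reachable a b}) := mul_le_mul_of_nonneg_left hθ hβ0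
    _ = (1 - (∏ v ∈ univ.filter (fun v => v ≠ c), (1 - (w s(c, v) : ℝ)))) * ((∏ v ∈ univ.filter (fun v => v ≠ c), (1 - (w s(c, v) : ℝ))) * (prodBernoulli w).real {ω : Set (Sym2 V) | (openGraph (ω \ {e : Sym2 V | c ∈ e})).Reachable a b}) := by ring
    _ ≤ (1 - (∏ v ∈ univ.filter (fun v => v ≠ c), (1 - (w s(c, v) : ℝ)))) * (prodBernoulli w).real ((openConn a b : Set (Set (Sym2 V))) ∩ ((openConn a c : Set (Set (Sym2 V))))ᶜ) :=
          mul_le_mul_of_nonneg_left hw (sub_nonneg.2 hβ1)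


end GZHub

end Summit.CriticalPhenomena.PercolationContinuityZ3.Theorems

end
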